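import Literature.NumberTheory.EllipticCurves.BinaryQuarticTwoCoveringsLocal
import Literature.NumberTheory.EllipticCurves.BinaryQuarticTwoCoveringsEquiv
import Literature.NumberTheory.EllipticCurves.BinaryQuarticFormsProofs
import Mathlib.NumberTheory.Padics.HeightOneSpectrum
import Mathlib.NumberTheory.NumberField.InfinitePlace.TotallyRealComplex
import HarnessLib

/-!
# Two-coverings attached to binary quartic forms, V: the map from locally soluble forms to the
# `2`-Selmer group

Topic `Literature/NumberTheory/EllipticCurves`. Fifth file of the theory proving the named fact
`Literature.NumberTheory.EllipticCurves.bhargavaShankar_card_selmerTwo_eq_kEquivClassCount`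
(`BinaryQuarticMinimisation.lean`; Bhargava–Shankar 2015, held arXiv text §5.1, Lemma 5.2 and the
sentence following it: the `2`-Selmer group of `E_{A,B}` is in bijection with the equivalence
classes of locally soluble integral binary quartic forms with invariants `λ⁴I(E)`, `λ⁶J(E)`).

For `(A, B)` and the set
`S = {f ∈ V_ℤ : f locally soluble, ∃ t ∈ ℚˣ, I(f) = −3At⁴, J(f) = −27Bt⁶}` of the named fact,
this file constructs the map `f ↦ [f] ∈ Sel₂(E_{A,B})` and proves it is well defined on
`ℚ`-equivalence classes:

* `selmerClass_mem_selmerGroup_iff_isLocallySoluble`: for a form `g` over `ℚ` in the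
  `E_{A,B}`-family (with `a ≠ 0`) the class `[g] ∈ H¹(ℚ, E[2])` of files II–IV lies in the tree's
  `WeierstrassCurve.selmerGroup _ 2` **iff** `g` is locally soluble (file III at every completion,
  transported along Mathlib's `ℚ_v ≃ ℚ_[p]` and `ℚ_∞ ≃ ℝ`) — Cassels' description of the Selmer
  group by everywhere locally soluble `2`-coverings (LEC §23; Cremona 2001 §5), i.e. the local
  content of Bhargava–Shankar's Lemma 5.2;
* `TwoCovering.normRep f`: a `GL₂(ℤ)`-translate `f((x, y)·(1 k; 0 1))` of an integral form with
  nonzero leading coefficient (`a(normRep f) ≠ 0` as soon as `f ≠ 0`), so that the class is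
  defined for every `f ∈ S`; `TwoCovering.selmerClassOf f` — the Selmer element of `f ∈ S`
  (`selmerClassOf_mem`);
* `selmerClassOf_eq_of_kEquiv`: `ℚ`-equivalent members of `S` have the same Selmer element
  (file IV), so `f ↦ [f]` descends to the set of equivalence classes counted by
  `kEquivClassCount S`.

Injectivity on classes and surjectivity onto the Selmer group are the subject of the sequel files.

## References

* M. Bhargava, A. Shankar, Ann. of Math. (2) 181 (2015), §5.1 of arXiv:1006.1002v2, Lemma 5.2
  and the sentence following it. [BhargavaShankarAnnals2015]
* J. E. Cremona, *Classical invariants and 2-descent on elliptic curves*, J. Symbolic Comput. 31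
  (2001), §5. [Cremona2001]
* J. W. S. Cassels, *Lectures on Elliptic Curves* (1991), §23 (the Selmer group as the
  everywhere locally soluble `2`-coverings).
-/

noncomputable section

open scoped Classical

namespace Literature.NumberTheory.EllipticCurves

open IsDedekindDomain NumberField WeierstrassCurve

namespace BinaryQuartic

/-! ## §1 Transport of solubility along field isomorphisms -/

section Transport

variable {K L : Type*} [Field K] [Field L]

/-- `map` is functorial (local copy of `BinaryQuartic.map_map` of `BinaryQuarticMinimisationProofs`,
not imported here). [folklore] -/
theorem map_map' {R S T : Type*} [CommRing R] [CommRing S] [CommRing T] (φ : R →+* S) (ψ : S →+* T)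
    (f : BinaryQuartic R) : (f.map φ).map ψ = f.map (ψ.comp φ) := rfl

/-- Solubility is transported along ring homomorphisms of fields (injective): a solution of
`z² = f(x, y)` over `K` gives one over `L`. [folklore] -/
theorem IsSoluble.map (ψ : K →+* L) {f : BinaryQuartic K} (h : f.IsSoluble) : (f.map ψ).IsSoluble := by
  obtain ⟨x, y, z, hxy, hz⟩ := h
  refine ⟨ψ x, ψ y, ψ z, ?_, ?_⟩
  · rcases hxy with hx | hy
    · exact Or.inl ((map_ne_zero ψ).mpr hx)
    · exact Or.inr ((map_ne_zero ψ).mpr hy)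
  · rw [eval_map, ← hz, map_pow]

/-- **Transport of solubility along a field isomorphism**, for forms coming from `ℚ`: all ring
homomorphisms `ℚ → K` agree, so `f ⊗ K` soluble iff `f ⊗ L` soluble when `K ≃+* L`. [folklore] -/
theorem isSoluble_map_iff_of_ringEquiv (e : K ≃+* L) (φ : ℚ →+* K) (ψ : ℚ →+* L) (f : BinaryQuartic ℚ) :
    (f.map φ).IsSoluble ↔ (f.map ψ).IsSoluble := by
  have h1 : (e : K →+* L).comp φ = ψ := Subsingleton.elim _ _
  have h2 : (e.symm : L →+* K).comp ψ = φ := Subsingleton.elim _ _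
  constructor
  · intro h
    have := h.map (e : K →+* L)
    rwa [map_map', h1] at this
  · intro h
    have := h.map (e.symm : L →+* K)
    rwa [map_map', h2] at this

/-- An integral form mapped to a ring factors through `ℚ` (as maps `ℤ → ℚ → R`). [folklore] -/
theorem map_intCast_eq (R : Type*) [CommRing R] (φ : ℚ →+* R) (f : BinaryQuartic ℤ) :
    f.map (Int.castRingHom R) = (f.map (Int.castRingHom ℚ)).map φ := by
  rw [map_map', RingHom.ext_int (φ.comp (Int.castRingHom ℚ)) (Int.castRingHom R)]

end Transport

/-! ## §2 Local solubility at the completions of `ℚ` -/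

section Completions

open Rat.HeightOneSpectrum

/-- **Local solubility at a finite place**: a locally soluble integral form is soluble over the
completion `ℚ_v` (transport from `ℚ_[p]`, `p` the prime under `v`, along Mathlib's
`adicCompletion.padicEquiv`). [folklore] -/
theorem IsLocallySoluble.isSoluble_adicCompletion {f : BinaryQuartic ℤ} (hf : f.IsLocallySoluble)
    (v : HeightOneSpectrum (𝓞 ℚ)) :
    ((f.map (Int.castRingHom ℚ)).map (algebraMap ℚ (v.adicCompletion ℚ))).IsSoluble := by
  haveI : Fact (primesEquiv (R := 𝓞 ℚ) v : ℕ).Prime := ⟨(primesEquiv (R := 𝓞 ℚ) v).2⟩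
  have h := hf.2 (primesEquiv (R := 𝓞 ℚ) v : ℕ)
  rw [map_intCast_eq _ (algebraMap ℚ _)] at h
  exact (isSoluble_map_iff_of_ringEquiv (adicCompletion.padicEquiv (R := 𝓞 ℚ) v).toRingEquiv
    (algebraMap ℚ _) (algebraMap ℚ _) _).mpr h

/-- **Local solubility at the infinite place**: a locally soluble integral form is soluble over the
completion `ℚ_∞` (transport from `ℝ` along `Completion.ringEquivRealOfIsReal`). [folklore] -/
theorem IsLocallySoluble.isSoluble_infinitePlace {f : BinaryQuartic ℤ} (hf : f.IsLocallySoluble)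
    (w : InfinitePlace ℚ) :
    ((f.map (Int.castRingHom ℚ)).map (algebraMap ℚ w.Completion)).IsSoluble := by
  have h := hf.1
  rw [map_intCast_eq _ (algebraMap ℚ ℝ)] at h
  exact (isSoluble_map_iff_of_ringEquiv
    (InfinitePlace.Completion.ringEquivRealOfIsReal (IsTotallyReal.isReal w))
    (algebraMap ℚ _) (algebraMap ℚ ℝ) _).mpr h

/-- **Local solubility from the completions**: an integral form soluble over every `ℚ_v` (`v`
finite) and over `ℚ_∞` is locally soluble. [folklore] -/
theorem isLocallySoluble_of_completions {f : BinaryQuartic ℤ}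
    (hv : ∀ v : HeightOneSpectrum (𝓞 ℚ),
      ((f.map (Int.castRingHom ℚ)).map (algebraMap ℚ (v.adicCompletion ℚ))).IsSoluble)
    (hw : ∀ w : InfinitePlace ℚ, ((f.map (Int.castRingHom ℚ)).map (algebraMap ℚ w.Completion)).IsSoluble) :
    f.IsLocallySoluble := by
  constructor
  · have h := hw default
    rw [map_intCast_eq _ (algebraMap ℚ ℝ)]
    exact (isSoluble_map_iff_of_ringEquiv
      (InfinitePlace.Completion.ringEquivRealOfIsReal (IsTotallyReal.isReal default))
      (algebraMap ℚ _) (algebraMap ℚ ℝ) _).mp h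
  · intro p hp
    let P : Nat.Primes := ⟨p, hp.out⟩
    have h := hv ((primesEquiv (R := 𝓞 ℚ)).symm P)
    rw [map_intCast_eq _ (algebraMap ℚ ℚ_[p])]
    have e := (Padic.adicCompletionEquiv (R := 𝓞 ℚ) P).toRingEquiv
    exact (isSoluble_map_iff_of_ringEquiv e (algebraMap ℚ ℚ_[p]) (algebraMap ℚ _) _).mpr h

end Completions

/-! ## §3 A representative with nonzero leading coefficient -/

section NormRep

/-- The unipotent substitution `x ↦ x + ky` (matrix `(1 k; 0 1)`, determinant `1`). [folklore] -/
def shearMatrix (k : ℤ) : Matrix (Fin 2) (Fin 2) ℤ := !![1, k; 0, 1]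

/-- `det (1 k; 0 1) = 1`. [folklore] -/
@[simp] theorem det_shearMatrix (k : ℤ) : (shearMatrix k).det = 1 := by
  simp [shearMatrix, Matrix.det_fin_two]

/-- The leading coefficient of `f((x,y)(1 k; 0 1))` is `f(1, k)`. [folklore] -/
theorem subst_shearMatrix_a (f : BinaryQuartic ℤ) (k : ℤ) : (f.subst (shearMatrix k)).a = f.eval 1 k := by
  simp [subst, shearMatrix, BinaryQuartic.eval]

/-- An integral binary quartic form with `Δ ≠ 0` takes a nonzero value at some `(1, k)`, `k ∈ ℤ`
(a nonzero polynomial of degree `≤ 4` has at most `4` roots, and the zero form has `Δ = 0`).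
[folklore] -/
theorem exists_eval_one_ne_zero (f : BinaryQuartic ℤ) (hΔ : f.disc ≠ 0) : ∃ k : ℤ, f.eval 1 k ≠ 0 := by
  by_contra h
  push Not at h
  apply hΔ
  -- the polynomial `e X⁴ + d X³ + c X² + b X + a` vanishes on `ℤ`
  let P : Polynomial ℤ := Polynomial.C f.e * Polynomial.X ^ 4 + Polynomial.C f.d * Polynomial.X ^ 3 +
    Polynomial.C f.c * Polynomial.X ^ 2 + Polynomial.C f.b * Polynomial.X + Polynomial.C f.a
  have hP : ∀ k : ℤ, P.eval k = 0 := fun k ↦ by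
    have := h k
    simp only [BinaryQuartic.eval, one_pow, mul_one] at this
    simp only [P, Polynomial.eval_add, Polynomial.eval_mul, Polynomial.eval_C, Polynomial.eval_pow,
      Polynomial.eval_X]
    linear_combination this
  have hdeg : P.natDegree ≤ 4 := by
    simp only [P]
    compute_degree
  have hP0 : P = 0 := by
    apply Polynomial.eq_zero_of_natDegree_lt_card_of_eval_eq_zero' P (Finset.image (fun i : Fin 5 ↦ (i : ℤ)) Finset.univ)
    · intro x _; exact hP x
    · rw [Finset.card_image_of_injective _ (fun i j hij ↦ Fin.ext (by exact_mod_cast hij))]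
      simp only [Finset.card_univ, Fintype.card_fin]
      omega
  have hc : ∀ n, P.coeff n = 0 := fun n ↦ by rw [hP0, Polynomial.coeff_zero]
  have h4 := hc 4; have h3 := hc 3; have h2 := hc 2; have h1 := hc 1; have h0 := hc 0
  simp only [P, Polynomial.coeff_add, Polynomial.coeff_C_mul, Polynomial.coeff_X_pow,
    Polynomial.coeff_X, Polynomial.coeff_C] at h4 h3 h2 h1 h0
  norm_num at h4 h3 h2 h1 h0
  simp [BinaryQuartic.disc, h4, h3, h2, h1, h0]

/-- The chosen shift `k` with `f(1, k) ≠ 0` (when one exists; `0` otherwise). [folklore] -/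
def normShift (f : BinaryQuartic ℤ) : ℤ :=
  if h : ∃ k : ℤ, f.eval 1 k ≠ 0 then Classical.choose h else 0

/-- `f(1, normShift f) ≠ 0` when `Δ(f) ≠ 0`. [folklore] -/
theorem eval_one_normShift_ne_zero (f : BinaryQuartic ℤ) (hΔ : f.disc ≠ 0) : f.eval 1 (normShift f) ≠ 0 := by
  rw [normShift, dif_pos (exists_eval_one_ne_zero f hΔ)]
  exact Classical.choose_spec (exists_eval_one_ne_zero f hΔ)

/-- **The normalised representative** of an integral form: the rational form
`f((x, y)(1 k; 0 1)) ⊗ ℚ` with `k = normShift f`, which has nonzero leading coefficient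
`f(1, k)` when `Δ(f) ≠ 0` and is `ℚ`-equivalent (indeed `GL₂(ℤ)`-equivalent) to `f`. [folklore] -/
def normRep (f : BinaryQuartic ℤ) : BinaryQuartic ℚ :=
  (f.subst (shearMatrix (normShift f))).map (Int.castRingHom ℚ)

/-- `f` and its sheared form are `GL₂(ℤ)`-equivalent. [folklore] -/
theorem gl2zEquiv_subst_shearMatrix (f : BinaryQuartic ℤ) (k : ℤ) : GL2ZEquiv f (f.subst (shearMatrix k)) :=
  ⟨shearMatrix k, by simp, rfl⟩

/-- The normalised representative has nonzero leading coefficient (for `Δ(f) ≠ 0`). [folklore] -/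
theorem normRep_a_ne_zero (f : BinaryQuartic ℤ) (hΔ : f.disc ≠ 0) : (normRep f).a ≠ 0 := by
  rw [normRep, map_a, subst_shearMatrix_a, eq_intCast, Int.cast_ne_zero]
  exact eval_one_normShift_ne_zero f hΔ

/-- The normalised representative has the same invariant `I` (the shear has determinant `1`).
[folklore] -/
theorem I_normRep (f : BinaryQuartic ℤ) : (normRep f).I = (f.I : ℚ) := by
  rw [normRep, I_map, I_subst, det_shearMatrix, one_pow, one_mul, eq_intCast]

/-- The normalised representative has the same invariant `J`. [folklore] -/
theorem J_normRep (f : BinaryQuartic ℤ) : (normRep f).J = (f.J : ℚ) := by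
  rw [normRep, J_map, J_subst, det_shearMatrix, one_pow, one_mul, eq_intCast]

/-- The normalised representative is `ℚ`-equivalent to `f ⊗ ℚ` (with `μ = 1`, `γ` the shear).
[folklore] -/
theorem kEquiv_normRep (f : BinaryQuartic ℤ) : KEquiv (f.map (Int.castRingHom ℚ)) (normRep f) := by
  refine ⟨1, one_ne_zero, (shearMatrix (normShift f)).map (Int.castRingHom ℚ), ?_, ?_⟩
  · rw [show (shearMatrix (normShift f)).map (Int.castRingHom ℚ) =
        (Int.castRingHom ℚ).mapMatrix (shearMatrix (normShift f)) from rfl, ← RingHom.map_det,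
      det_shearMatrix, map_one]
    exact one_ne_zero
  · rw [normRep, map_subst, one_pow, one_smul]

/-- The normalised representative is `ℚ`-equivalent to `f ⊗ ℚ` in the explicit form
`normRep f = 1² · ((f ⊗ ℚ).subst γ)`. [folklore] -/
theorem normRep_eq_smul_subst (f : BinaryQuartic ℤ) :
    normRep f = (1 : ℚ) ^ 2 • (f.map (Int.castRingHom ℚ)).subst
      ((shearMatrix (normShift f)).map (Int.castRingHom ℚ)) := by
  rw [normRep, map_subst, one_pow, one_smul]

/-- Local solubility is unchanged by the shear. [folklore] -/
theorem isLocallySoluble_subst_shearMatrix_iff (f : BinaryQuartic ℤ) (k : ℤ) :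
    (f.subst (shearMatrix k)).IsLocallySoluble ↔ f.IsLocallySoluble :=
  (gl2zEquiv_subst_shearMatrix f k).isLocallySoluble_iff

end NormRep

end BinaryQuartic

namespace TwoCovering

open BinaryQuartic GaloisRepresentations

/-! ## §4 The Selmer condition is local solubility -/

section SelmerIff

variable {AB : ℤ × ℤ} {f : BinaryQuartic ℤ} {g : BinaryQuartic ℚ} {t : ℚ} {r₀ : AlgebraicClosure ℚ}

/-- **The Selmer condition is everywhere local solubility.** For an integral form `f` whose
rational normalisation `g = μ²(γ · f) ⊗ ℚ`… — more precisely for any rational form `g` in the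
`E_{A,B}`-family which is the base change of an integral form `f` up to `GL₂(ℤ)` — the class
`[g] ∈ H¹(ℚ, E_{A,B}[2])` lies in the `2`-Selmer group iff `f` is locally soluble. Here in the basic
form: `g = f' ⊗ ℚ` for an integral `f'` `GL₂(ℤ)`-equivalent to `f`. (Cassels, LEC §23: the Selmer
group consists of the `2`-coverings with points everywhere locally; Bhargava–Shankar Lemma 5.2.)
[cite: BhargavaShankarAnnals2015, Lemma 5.2 and the sentence following it (arXiv:1006.1002v2 numbering)] -/
theorem selmerClass_mem_selmerGroup_iff (h : Setup g (AB.1 : ℚ) (AB.2 : ℚ) t)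
    (hr₀ : (g.map (algebraMap ℚ (AlgebraicClosure ℚ))).eval r₀ 1 = 0) {f' : BinaryQuartic ℤ}
    (hg : g = f'.map (Int.castRingHom ℚ)) (hff' : GL2ZEquiv f f') :
    selmerClass h hr₀ ∈ selmerGroup (shortWeierstrass AB) 2 ↔ f.IsLocallySoluble := by
  rw [mem_selmerGroup_iff, ← hff'.isLocallySoluble_iff]
  constructor
  · rintro ⟨hv, hw⟩
    refine isLocallySoluble_of_completions (fun v ↦ ?_) (fun w ↦ ?_)
    · have := (selmerClass_mem_selmerLocalKer_iff_isSoluble h hr₀ (v.adicCompletion ℚ)).mp (hv v)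
      rwa [hg] at this
    · have := (selmerClass_mem_selmerLocalKer_iff_isSoluble h hr₀ w.Completion).mp (hw w)
      rwa [hg] at this
  · intro hsol
    refine ⟨fun v ↦ ?_, fun w ↦ ?_⟩
    · rw [selmerClass_mem_selmerLocalKer_iff_isSoluble h hr₀ (v.adicCompletion ℚ), hg]
      exact hsol.isSoluble_adicCompletion v
    · rw [selmerClass_mem_selmerLocalKer_iff_isSoluble h hr₀ w.Completion, hg]
      exact hsol.isSoluble_infinitePlace w

end SelmerIff

/-! ## §5 The Selmer element of a locally soluble form -/

section SelmerClassOf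

variable (AB : ℤ × ℤ)

/-- **Bhargava–Shankar's set of forms** attached to `E_{A,B}`: the locally soluble integral binary
quartic forms with invariants `I = −3At⁴`, `J = −27Bt⁶` for some `t ∈ ℚˣ` — the set whose
equivalence classes are counted in
`Literature.NumberTheory.EllipticCurves.bhargavaShankar_card_selmerTwo_eq_kEquivClassCount`.
[cite: BhargavaShankarAnnals2015, §5.1, sentence after the definition of local solubility (arXiv:1006.1002v2 numbering)] -/
def selmerFormSet : Set (BinaryQuartic ℤ) :=
  {f : BinaryQuartic ℤ | f.IsLocallySoluble ∧ ∃ t : ℚ, t ≠ 0 ∧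
    (f.I : ℚ) = t ^ 4 * (-3 * AB.1) ∧ (f.J : ℚ) = t ^ 6 * (-27 * AB.2)}

/-- Unfolding membership in `selmerFormSet`. [folklore] -/
theorem mem_selmerFormSet_iff (f : BinaryQuartic ℤ) : f ∈ selmerFormSet AB ↔
    f.IsLocallySoluble ∧ ∃ t : ℚ, t ≠ 0 ∧ (f.I : ℚ) = t ^ 4 * (-3 * AB.1) ∧ (f.J : ℚ) = t ^ 6 * (-27 * AB.2) :=
  Iff.rfl

variable {AB}

/-- The chosen scalar `t` of a member of `selmerFormSet`. [folklore] -/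
def scalarOf {f : BinaryQuartic ℤ} (hf : f ∈ selmerFormSet AB) : ℚ :=
  Classical.choose hf.2

/-- The defining properties of the chosen scalar. [folklore] -/
theorem scalarOf_spec {f : BinaryQuartic ℤ} (hf : f ∈ selmerFormSet AB) :
    scalarOf hf ≠ 0 ∧ (f.I : ℚ) = scalarOf hf ^ 4 * (-3 * AB.1) ∧ (f.J : ℚ) = scalarOf hf ^ 6 * (-27 * AB.2) :=
  Classical.choose_spec hf.2

/-- `Δ(f) ≠ 0` for members of `selmerFormSet` when `4A³ + 27B² ≠ 0`. [folklore] -/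
theorem disc_ne_zero_of_mem {f : BinaryQuartic ℤ} (hf : f ∈ selmerFormSet AB)
    (hE : 4 * AB.1 ^ 3 + 27 * AB.2 ^ 2 ≠ 0) : f.disc ≠ 0 := by
  obtain ⟨ht, hI, hJ⟩ := scalarOf_spec hf
  intro h0
  have h27 := twentySeven_mul_disc f
  rw [h0, mul_zero] at h27
  have h27' : (4 : ℚ) * (f.I : ℚ) ^ 3 - (f.J : ℚ) ^ 2 = 0 := by exact_mod_cast h27.symm
  rw [hI, hJ] at h27'
  have hE' : (4 : ℚ) * (AB.1 : ℚ) ^ 3 + 27 * (AB.2 : ℚ) ^ 2 ≠ 0 := by exact_mod_cast hE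
  have : (scalarOf hf) ^ 12 * ((4 : ℚ) * (AB.1 : ℚ) ^ 3 + 27 * (AB.2 : ℚ) ^ 2) = 0 := by
    linear_combination (-1 / 27 : ℚ) * h27'
  exact mul_ne_zero (pow_ne_zero _ ht) hE' this

/-- **The normalised representative of a member of `selmerFormSet` is in the `E_{A,B}`-family**
(`Setup`, files II–IV). [folklore] -/
theorem setup_normRep {f : BinaryQuartic ℤ} (hf : f ∈ selmerFormSet AB) (hE : 4 * AB.1 ^ 3 + 27 * AB.2 ^ 2 ≠ 0) :
    Setup (normRep f) (AB.1 : ℚ) (AB.2 : ℚ) (scalarOf hf) where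
  a_ne := normRep_a_ne_zero f (disc_ne_zero_of_mem hf hE)
  t_ne := (scalarOf_spec hf).1
  I_eq := by rw [I_normRep, (scalarOf_spec hf).2.1]; ring
  J_eq := by rw [J_normRep, (scalarOf_spec hf).2.2]; ring
  disc_ne := by exact_mod_cast hE

/-- A chosen root in `ℚ̄` of the normalised representative. [folklore] -/
def rootOf {f : BinaryQuartic ℤ} (hf : f ∈ selmerFormSet AB) (hE : 4 * AB.1 ^ 3 + 27 * AB.2 ^ 2 ≠ 0) :
    AlgebraicClosure ℚ :=
  (Classical.choice (RootData.nonempty (f := (normRep f).map (algebraMap ℚ (AlgebraicClosure ℚ)))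
    (by simpa using (setup_normRep hf hE).a_ne))).r 0

/-- The chosen root is a root. [folklore] -/
theorem eval_rootOf {f : BinaryQuartic ℤ} (hf : f ∈ selmerFormSet AB) (hE : 4 * AB.1 ^ 3 + 27 * AB.2 ^ 2 ≠ 0) :
    ((normRep f).map (algebraMap ℚ (AlgebraicClosure ℚ))).eval (rootOf hf hE) 1 = 0 :=
  RootData.eval_r _ 0

/-- **The Selmer element of a locally soluble form** `f ∈ selmerFormSet AB`: the class in
`H¹(ℚ, E_{A,B}[2])` of the `2`-covering `z² = f(x, y)` (computed on the normalised representative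
with the chosen scalar and root; independent of these choices by files II and IV).
Bhargava–Shankar, Lemma 5.2. [cite: BhargavaShankarAnnals2015, Lemma 5.2 (arXiv:1006.1002v2 numbering)] -/
def selmerClassOf {f : BinaryQuartic ℤ} (hf : f ∈ selmerFormSet AB) (hE : 4 * AB.1 ^ 3 + 27 * AB.2 ^ 2 ≠ 0) :
    galH1Torsion (shortWeierstrass AB) 2 :=
  selmerClass (setup_normRep hf hE) (eval_rootOf hf hE)

/-- **The Selmer element of a locally soluble form lies in the `2`-Selmer group** (file III at every
place). Bhargava–Shankar, Lemma 5.2; Cassels, LEC §23. [cite: BhargavaShankarAnnals2015, Lemma 5.2 (arXiv:1006.1002v2 numbering)] -/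
theorem selmerClassOf_mem {f : BinaryQuartic ℤ} (hf : f ∈ selmerFormSet AB) (hE : 4 * AB.1 ^ 3 + 27 * AB.2 ^ 2 ≠ 0) :
    selmerClassOf hf hE ∈ selmerGroup (shortWeierstrass AB) 2 :=
  (selmerClass_mem_selmerGroup_iff (setup_normRep hf hE) (eval_rootOf hf hE) rfl
    (gl2zEquiv_subst_shearMatrix f _)).mpr hf.1

/-- `K`-equivalence is symmetric (local copy of `KEquiv.symm` of `BinaryQuarticMinimisationProofs`,
not imported here). [folklore] -/
theorem kEquiv_symm {K : Type*} [Field K] {f g : BinaryQuartic K} (h : KEquiv f g) : KEquiv g f := by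
  obtain ⟨μ, hμ, γ, hγ, rfl⟩ := h
  have hγu : IsUnit γ.det := isUnit_iff_ne_zero.mpr hγ
  refine ⟨μ⁻¹, inv_ne_zero hμ, γ⁻¹, ?_, ?_⟩
  · exact isUnit_iff_ne_zero.mp (Matrix.isUnit_nonsing_inv_det_iff.mpr hγu)
  · rw [smul_subst, ← subst_mul, Matrix.nonsing_inv_mul γ hγu, subst_one, smul_smul, inv_pow,
      inv_mul_cancel₀ (pow_ne_zero 2 hμ), one_smul]

/-- `K`-equivalence is transitive (local copy of `KEquiv.trans`). [folklore] -/
theorem kEquiv_trans {K : Type*} [Field K] {f g h : BinaryQuartic K} (h₁ : KEquiv f g) (h₂ : KEquiv g h) :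
    KEquiv f h := by
  obtain ⟨μ₁, hμ₁, γ₁, hγ₁, rfl⟩ := h₁
  obtain ⟨μ₂, hμ₂, γ₂, hγ₂, rfl⟩ := h₂
  refine ⟨μ₂ * μ₁, mul_ne_zero hμ₂ hμ₁, γ₂ * γ₁, by rw [Matrix.det_mul]; exact mul_ne_zero hγ₂ hγ₁, ?_⟩
  rw [smul_subst, smul_smul, subst_mul, mul_pow]

/-- **Well-definedness on equivalence classes**: `ℚ`-equivalent members of `selmerFormSet AB` have
the same Selmer element (file IV, `selmerClass_eq_of_kEquiv`, applied to the normalised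
representatives). [cite: BhargavaShankarAnnals2015, Lemma 5.2 (arXiv:1006.1002v2 numbering)] -/
theorem selmerClassOf_eq_of_kEquiv {f g : BinaryQuartic ℤ} (hf : f ∈ selmerFormSet AB)
    (hg : g ∈ selmerFormSet AB) (hE : 4 * AB.1 ^ 3 + 27 * AB.2 ^ 2 ≠ 0)
    (hfg : KEquiv (f.map (Int.castRingHom ℚ)) (g.map (Int.castRingHom ℚ))) :
    selmerClassOf hf hE = selmerClassOf hg hE := by
  -- `normRep f ∼ f ⊗ ℚ ∼ g ⊗ ℚ ∼ normRep g`
  have hfg' : KEquiv (normRep f) (normRep g) :=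
    kEquiv_trans (kEquiv_symm (kEquiv_normRep f)) (kEquiv_trans hfg (kEquiv_normRep g))
  obtain ⟨μ, hμ, γ, hγ, hrep⟩ := hfg'
  exact (selmerClass_eq_of_kEquiv (setup_normRep hf hE) (setup_normRep hg hE) hμ hγ hrep
    (eval_rootOf hf hE) (eval_rootOf hg hE)).symm

end SelmerClassOf

end TwoCovering

end Literature.NumberTheory.EllipticCurves
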